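import Literature.NumberTheory.Automorphic.StandardLTheoryGL2
import Literature.NumberTheory.Automorphic.CuspidalGL2LocalEulerFactorUnramified
import Literature.NumberTheory.Automorphic.CuspidalGL2TwistedLocalFactorVanishing
import Literature.NumberTheory.Automorphic.CuspidalTransposeInv
import Literature.NumberTheory.Automorphic.GL2SphericalOfLFactorDegreeTwo
import HarnessLib

/-!
# The standard `L`-function theory of cuspidal `GL(2)` (`JacquetLanglands1970_standardLTheoryGL2`)
# reduced to the global Hecke theory of the canonical local Euler polynomials

Topic `Literature/NumberTheory/Automorphic`; proof file (theorems only: no definition, no named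
fact, no instance).  The named fact `JacquetLanglands1970_standardLTheoryGL2` (Jacquet–Langlands
1970, Thm. 11.1, Cor. 11.2 with Thm. 2.18, Props. 3.5, 3.6, 3.8; `StandardLTheoryGL2.lean`) asks
for local polynomials `L π u`, `L' π u` attached to every cuspidal automorphic representation `π`
of `GL₂(𝔸_F)` (Borel–Jacquet datum) and every finite place, with: (deg) `P(0) = 1`, `deg ≤ 2`;
(an) Euler products, meromorphic continuation and functional equation `Λ(s) = ε(s) Λ'(1 - s)`;
(U) at unramified places `L = ∏ (1 - aᵢ X)`, `L' = ∏ (1 - aᵢ⁻¹ X)` over the Satake parameter;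
(R) ramified twists of unramified `π_u` kill both factors; (N) sufficiently ramified twists kill
both factors; (conv-U) `deg L π u = 2 ⇒ π` unramified at `u` with `L π u = ∏ (1 - bᵢ X)`, `bᵢ ≠ 0`.

**This file proves all of it EXCEPT the global analytic clause (an), from the local theory now in
the tree**, with the CANONICAL choices

* `L π u :=` the local Euler polynomial of `π` at `u` (`exists_localEulerPolynomial`,
  `CuspidalGL2LocalEulerFactor`: the JPSS `L`-polynomial `L(s, π_u × 1)⁻¹` of every irreducible
  smooth local component `π_u`, independent of all choices; Jacquet–Langlands 1970, Thm. 2.18),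
* `L' π u := L π^τ u`, `π^τ = π ∘ (g ↦ w ᵗg⁻¹ w)` the transpose-inverse twist
  (`CuspidalAutomorphicRepData.transposeInv`, `CuspidalTransposeInv`), a realisation of the
  contragredient `π̃` (Jacquet–Langlands 1970, proof of Thm. 11.1),

and takes clause (an) for THESE polynomials as the hypothesis `hR1` — the global Hecke theory of
Jacquet–Langlands 1970, §§9–11 (Thm. 11.1: `L(s, π) = ∏_u L(s, π_u)` is entire, bounded in
vertical strips and satisfies `L(s, π) = ε(s, π) L(1 - s, π̃)`), stated over the universal property
of the local Euler polynomials (so that no definition is needed):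
`JacquetLanglands1970_standardLTheoryGL2_of_globalHeckeTheory`.

The clauses are discharged by: (deg) `exists_localEulerPolynomial`; (U)
`localEulerPolynomial_eq_satakePairPolynomial_of_hasSatakeParamAt` (`CuspidalGL2LocalEulerFactorUnramified`;
Jacquet–Langlands Prop. 3.5, Flath) and `HasSatakeParamAt.transposeInv` (`t_{π^τ} = t_π⁻¹`);
(R), (N) `hasRSLFactor_localComponent_twist_eq_one_of_not_isUnramifiedAt`,
`exists_bound_hasRSLFactor_localComponent_twist_eq_one` (`CuspidalGL2TwistedLocalFactorVanishing`;
Jacquet–Langlands Props. 3.5, 3.6, 3.8) and `transposeInv_twist` (`(π ⊗ ω)^τ = π^τ ⊗ ω⁻¹`);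
(conv-U) `exists_mem_fixedPoints_glInt_of_hasRSLFactor_natDegree_two`
(`GL2SphericalOfLFactorDegreeTwo`; Jacquet–Langlands Props. 3.5–3.6 read backwards),
`isUnramifiedAt_of_hasLocalComponentAt_of_mem_fixedPoints_glInt` (Flath) and
`hasSatakeParamAt_ne_zero_holds` (Cartier).

## References

* H. Jacquet, R. P. Langlands, *Automorphic Forms on GL(2)*, LNM 114 (1970), Thm. 2.18,
  Props. 3.5, 3.6, 3.8, Thm. 11.1, Cor. 11.2. [JacquetLanglands1970]
* H. Jacquet, I. I. Piatetski-Shapiro, J. A. Shalika, *Rankin–Selberg convolutions*, Amer. J.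
  Math. 105 (1983), Thm. 2.7. [JacquetPiatetskiShapiroShalika1983]
* D. Flath, *Decomposition of representations into tensor products*, Corvallis 1979, Thm. 3.
  [FlathCorvallis1979]
* S. Gelbart, *Three lectures on the modularity of ρ̄_{E,3} and the Langlands reciprocity
  conjecture* (1997), Thm. 3.2, Prop. 4.1 (the consumer). [Gelbart1997]
-/

noncomputable section

open scoped MatrixGroups NNReal Classical NumberField Polynomial
open MeasureTheory NumberField IsDedekindDomain Polynomial

namespace Literature.NumberTheory.Automorphic

open Literature.NumberTheory.GaloisRepresentations (HeckeCharacter)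

section Helpers

variable {F : Type} [Field F] [NumberField F] {hcpt : isCompact_glFiniteIntegralLevel 2 F}

/-- `eulerPolynomial α = ∏ (1 - aX) = satakePairPolynomial α {1}`. [folklore] -/
private theorem eulerPolynomial_eq_satakePairPolynomial (α : Multiset ℂ) :
    eulerPolynomial α = satakePairPolynomial α {1} := by
  rw [satakePairPolynomial_singleton_one]
  rfl

/-- `ω` is ramified at `u` iff `ω⁻¹` is. [folklore] -/
private theorem isUnramifiedAt_inv_iff' {ω : HeckeCharacter F} {u : HeightOneSpectrum (𝓞 F)} :
    ω⁻¹.IsUnramifiedAt u ↔ ω.IsUnramifiedAt u := by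
  refine forall_congr' fun x => ?_
  rw [GaloisRepresentations.HeckeCharacter.localComponent_apply,
    GaloisRepresentations.HeckeCharacter.localComponent_apply,
    GaloisRepresentations.HeckeCharacter.inv_apply, inv_eq_one]

/-- A polynomial with the universal property of the local Euler polynomial of `π'` at `u` is `1`
as soon as every JPSS `L`-polynomial of every local component of `π'` at `u` is `1` (a local
component, Tate's character and an invariant measure exist). [folklore] -/
private theorem eq_one_of_forall_localComponent (π' : CuspidalAutomorphicRepData 2 F hcpt)
    (u : HeightOneSpectrum (𝓞 F)) {P : ℂ[X]}
    (hP : ∀ (πu : SmoothIrrep (GL (Fin 2) (u.adicCompletion F))), π'.1.HasLocalComponentAt u πu.ρ →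
      ∀ (ψ : AddChar (u.adicCompletion F) Circle), ψ.IsContinuousNontrivial →
      ∀ [MeasurableSpace (u.adicCompletion F)] [BorelSpace (u.adicCompletion F)]
        [MeasurableSpace (GL (Fin 1) (u.adicCompletion F) ⧸ upperUnitriangular (Fin 1) (u.adicCompletion F))]
        [BorelSpace (GL (Fin 1) (u.adicCompletion F) ⧸ upperUnitriangular (Fin 1) (u.adicCompletion F))]
        (ν : Measure (GL (Fin 1) (u.adicCompletion F) ⧸ upperUnitriangular (Fin 1) (u.adicCompletion F)))
        [SMulInvariantMeasure (GL (Fin 1) (u.adicCompletion F))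
          (GL (Fin 1) (u.adicCompletion F) ⧸ upperUnitriangular (Fin 1) (u.adicCompletion F)) ν]
        [IsFiniteMeasureOnCompacts ν] [ν.IsOpenPosMeasure],
        HasRSLFactor Nat.one_lt_two πu.ρ
          (Representation.trivial ℂ (GL (Fin 1) (u.adicCompletion F)) ℂ) ψ ν P)
    (h : ∀ (ρ' : SmoothIrrep (GL (Fin 2) (u.adicCompletion F))),
        π'.1.HasLocalComponentAt u ρ'.ρ →
      ∀ (ψ : AddChar (u.adicCompletion F) Circle), ψ.IsContinuousNontrivial →
      ∀ [MeasurableSpace (u.adicCompletion F)] [BorelSpace (u.adicCompletion F)]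
        [MeasurableSpace (GL (Fin 1) (u.adicCompletion F) ⧸ upperUnitriangular (Fin 1) (u.adicCompletion F))]
        [BorelSpace (GL (Fin 1) (u.adicCompletion F) ⧸ upperUnitriangular (Fin 1) (u.adicCompletion F))]
        (ν : Measure (GL (Fin 1) (u.adicCompletion F) ⧸ upperUnitriangular (Fin 1) (u.adicCompletion F)))
        [SMulInvariantMeasure (GL (Fin 1) (u.adicCompletion F))
          (GL (Fin 1) (u.adicCompletion F) ⧸ upperUnitriangular (Fin 1) (u.adicCompletion F)) ν]
        [IsFiniteMeasureOnCompacts ν] [ν.IsOpenPosMeasure] (Q : ℂ[X]),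
        HasRSLFactor Nat.one_lt_two ρ'.ρ
          (Representation.trivial ℂ (GL (Fin 1) (u.adicCompletion F)) ℂ) ψ ν Q → Q = 1) :
    P = 1 := by
  obtain ⟨ρ', hρ'⟩ := AutomorphicRepData.exists_hasLocalComponentAt_of_isAdmissible
    (automorphicRep_isAdmissible_holds hcpt) π'.1 u
  have hψ₀ : ((adeleAddChar F).adicComponent u).IsContinuousNontrivial :=
    (isGlobalAddChar_adeleAddChar F).isContinuousNontrivial_adicComponent
      (adicComponent_adeleAddChar_ne_one u)
  letI mF : MeasurableSpace (u.adicCompletion F) := borel _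
  haveI : BorelSpace (u.adicCompletion F) := ⟨rfl⟩
  letI mQ : MeasurableSpace
      (GL (Fin 1) (u.adicCompletion F) ⧸ upperUnitriangular (Fin 1) (u.adicCompletion F)) := borel _
  haveI : BorelSpace
      (GL (Fin 1) (u.adicCompletion F) ⧸ upperUnitriangular (Fin 1) (u.adicCompletion F)) := ⟨rfl⟩
  obtain ⟨μ', hμ', ν₀, hinv₀, hfin₀, hpos₀, -⟩ :=
    Literature.NumberTheory.EllipticCurves.Hida2000Thm326.exists_haar_measure_quotient_fin_one
      (F := u.adicCompletion F)
  haveI := hinv₀; haveI := hfin₀; haveI := hpos₀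
  exact h ρ' hρ' _ hψ₀ ν₀ P (hP ρ' hρ' _ hψ₀ ν₀)

end Helpers

/-- **The standard `L`-function theory of cuspidal `GL(2)` from the global Hecke theory of the
canonical local Euler polynomials** (Jacquet–Langlands 1970, Thm. 11.1 and Cor. 11.2 with
Thm. 2.18, Props. 3.5, 3.6, 3.8).  Hypothesis `hR1` = clause (an) of
`JacquetLanglands1970_standardLTheoryGL2` for any families `P`, `P'` of polynomials having the
universal property of the local Euler polynomials of `π` and of `π^τ` (`exists_localEulerPolynomial`,
`CuspidalAutomorphicRepData.transposeInv`): Euler products for `re s > c`, meromorphic `Λ, Λ'`,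
entire `Γ, Γ'` with zeros of finitely many ordinates, `ε` continuous non-vanishing,
`Λ(s) = ε(s) Λ'(1 - s)` — the global theory of Jacquet–Langlands 1970, §§9–11.  Conclusion: the
named fact `JacquetLanglands1970_standardLTheoryGL2`, with `L π u :=` the local Euler polynomial
of `π` at `u` and `L' π u := L π^τ u`; clauses (deg), (U), (R), (N), (conv-U) are PROVED here from
the local theory. [cite: JacquetLanglands1970, Thm. 11.1, Cor. 11.2, Thm. 2.18, Props. 3.5, 3.6, 3.8] -/
theorem JacquetLanglands1970_standardLTheoryGL2_of_globalHeckeTheory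
    (hR1 : ∀ {F : Type} [Field F] [NumberField F] (hcpt : isCompact_glFiniteIntegralLevel 2 F)
      (π : CuspidalAutomorphicRepData 2 F hcpt) (P P' : HeightOneSpectrum (𝓞 F) → ℂ[X]),
      (∀ (u : HeightOneSpectrum (𝓞 F)) (πu : SmoothIrrep (GL (Fin 2) (u.adicCompletion F))),
        π.1.HasLocalComponentAt u πu.ρ →
        ∀ (ψ : AddChar (u.adicCompletion F) Circle), ψ.IsContinuousNontrivial →
        ∀ [MeasurableSpace (u.adicCompletion F)] [BorelSpace (u.adicCompletion F)]
          [MeasurableSpace (GL (Fin 1) (u.adicCompletion F) ⧸ upperUnitriangular (Fin 1) (u.adicCompletion F))]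
          [BorelSpace (GL (Fin 1) (u.adicCompletion F) ⧸ upperUnitriangular (Fin 1) (u.adicCompletion F))]
          (ν : Measure (GL (Fin 1) (u.adicCompletion F) ⧸ upperUnitriangular (Fin 1) (u.adicCompletion F)))
          [SMulInvariantMeasure (GL (Fin 1) (u.adicCompletion F))
            (GL (Fin 1) (u.adicCompletion F) ⧸ upperUnitriangular (Fin 1) (u.adicCompletion F)) ν]
          [IsFiniteMeasureOnCompacts ν] [ν.IsOpenPosMeasure],
          HasRSLFactor Nat.one_lt_two πu.ρ
            (Representation.trivial ℂ (GL (Fin 1) (u.adicCompletion F)) ℂ) ψ ν (P u)) →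
      (∀ (u : HeightOneSpectrum (𝓞 F)) (πu : SmoothIrrep (GL (Fin 2) (u.adicCompletion F))),
        π.transposeInv.1.HasLocalComponentAt u πu.ρ →
        ∀ (ψ : AddChar (u.adicCompletion F) Circle), ψ.IsContinuousNontrivial →
        ∀ [MeasurableSpace (u.adicCompletion F)] [BorelSpace (u.adicCompletion F)]
          [MeasurableSpace (GL (Fin 1) (u.adicCompletion F) ⧸ upperUnitriangular (Fin 1) (u.adicCompletion F))]
          [BorelSpace (GL (Fin 1) (u.adicCompletion F) ⧸ upperUnitriangular (Fin 1) (u.adicCompletion F))]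
          (ν : Measure (GL (Fin 1) (u.adicCompletion F) ⧸ upperUnitriangular (Fin 1) (u.adicCompletion F)))
          [SMulInvariantMeasure (GL (Fin 1) (u.adicCompletion F))
            (GL (Fin 1) (u.adicCompletion F) ⧸ upperUnitriangular (Fin 1) (u.adicCompletion F)) ν]
          [IsFiniteMeasureOnCompacts ν] [ν.IsOpenPosMeasure],
          HasRSLFactor Nat.one_lt_two πu.ρ
            (Representation.trivial ℂ (GL (Fin 1) (u.adicCompletion F)) ℂ) ψ ν (P' u)) →
      ∃ (Λ Λ' Γ Γ' ε : ℂ → ℂ) (c : ℝ),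
        Meromorphic Λ ∧ Meromorphic Λ' ∧ Differentiable ℂ Γ ∧ Differentiable ℂ Γ' ∧
        (∃ Y : Set ℝ, Y.Finite ∧ ∀ s, Γ s = 0 → s.im ∈ Y) ∧
        (∃ Y : Set ℝ, Y.Finite ∧ ∀ s, Γ' s = 0 → s.im ∈ Y) ∧
        Continuous ε ∧ (∀ s, ε s ≠ 0) ∧ 1 ≤ c ∧
        (∀ s : ℂ, c < s.re →
          (Multipliable fun u : HeightOneSpectrum (𝓞 F) =>
              ((P u).eval ((u.residueCard : ℂ) ^ (-s)))⁻¹) ∧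
            (∀ u, (P u).eval ((u.residueCard : ℂ) ^ (-s)) ≠ 0) ∧
            Λ s * Γ s =
              ∏' u : HeightOneSpectrum (𝓞 F), ((P u).eval ((u.residueCard : ℂ) ^ (-s)))⁻¹) ∧
        (∀ s : ℂ, c < s.re →
          (Multipliable fun u : HeightOneSpectrum (𝓞 F) =>
              ((P' u).eval ((u.residueCard : ℂ) ^ (-s)))⁻¹) ∧
            (∀ u, (P' u).eval ((u.residueCard : ℂ) ^ (-s)) ≠ 0) ∧
            Λ' s * Γ' s =
              ∏' u : HeightOneSpectrum (𝓞 F), ((P' u).eval ((u.residueCard : ℂ) ^ (-s)))⁻¹) ∧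
        (∀ s, Λ s = ε s * Λ' (1 - s))) :
    JacquetLanglands1970_standardLTheoryGL2 := by
  intro F _ _ hcpt
  classical
  -- the canonical local Euler polynomials `L π u`, and `L' π u := L π^τ u`
  set L : CuspidalAutomorphicRepData 2 F hcpt → HeightOneSpectrum (𝓞 F) → ℂ[X] :=
    fun π u => Classical.choose (exists_localEulerPolynomial π u) with hLdef
  have hL : ∀ (π : CuspidalAutomorphicRepData 2 F hcpt) (u : HeightOneSpectrum (𝓞 F)),
      (L π u).eval 0 = 1 ∧ (L π u).natDegree ≤ 2 ∧
      ∀ (πu : SmoothIrrep (GL (Fin 2) (u.adicCompletion F))), π.1.HasLocalComponentAt u πu.ρ →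
      ∀ (ψ : AddChar (u.adicCompletion F) Circle), ψ.IsContinuousNontrivial →
      ∀ [MeasurableSpace (u.adicCompletion F)] [BorelSpace (u.adicCompletion F)]
        [MeasurableSpace (GL (Fin 1) (u.adicCompletion F) ⧸ upperUnitriangular (Fin 1) (u.adicCompletion F))]
        [BorelSpace (GL (Fin 1) (u.adicCompletion F) ⧸ upperUnitriangular (Fin 1) (u.adicCompletion F))]
        (ν : Measure (GL (Fin 1) (u.adicCompletion F) ⧸ upperUnitriangular (Fin 1) (u.adicCompletion F)))
        [SMulInvariantMeasure (GL (Fin 1) (u.adicCompletion F))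
          (GL (Fin 1) (u.adicCompletion F) ⧸ upperUnitriangular (Fin 1) (u.adicCompletion F)) ν]
        [IsFiniteMeasureOnCompacts ν] [ν.IsOpenPosMeasure],
        HasRSLFactor Nat.one_lt_two πu.ρ
          (Representation.trivial ℂ (GL (Fin 1) (u.adicCompletion F)) ℂ) ψ ν (L π u) :=
    fun π u => Classical.choose_spec (exists_localEulerPolynomial π u)
  set L' : CuspidalAutomorphicRepData 2 F hcpt → HeightOneSpectrum (𝓞 F) → ℂ[X] :=
    fun π u => L π.transposeInv u with hL'def
  -- clause (U) for `L`
  have hU : ∀ (π : CuspidalAutomorphicRepData 2 F hcpt) (u : HeightOneSpectrum (𝓞 F))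
      (β : Multiset ℂ), π.1.HasSatakeParamAt u β → L π u = eulerPolynomial β := fun π u β hβ => by
    rw [eulerPolynomial_eq_satakePairPolynomial]
    exact localEulerPolynomial_eq_satakePairPolynomial_of_hasSatakeParamAt π u hβ (hL π u).2.2
  -- clause (R) for `L`
  have hR : ∀ (π : CuspidalAutomorphicRepData 2 F hcpt) (ω : HeckeCharacter F)
      (hω : ω.IsFiniteOrder) (u : HeightOneSpectrum (𝓞 F)),
      π.1.IsUnramifiedAt u → ¬ ω.IsUnramifiedAt u → L (π.twist ω hω) u = 1 :=
    fun π ω hω u hπ hram =>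
      eq_one_of_forall_localComponent (π.twist ω hω) u (hL _ u).2.2
        fun ρ' hρ' ψ hψ _ _ _ _ ν _ _ _ Q hQ =>
          hasRSLFactor_localComponent_twist_eq_one_of_not_isUnramifiedAt π u hπ ω hω hram ρ' hρ'
            hψ ν hQ
  refine ⟨L, L', fun π u => ⟨(hL π u).1, (hL π u).2.1, (hL π.transposeInv u).1,
    (hL π.transposeInv u).2.1⟩, fun π => hR1 hcpt π (L π) (L' π) (fun u => (hL π u).2.2)
      (fun u => (hL π.transposeInv u).2.2), fun π u β hβ => ⟨hU π u β hβ, ?_⟩,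
    fun π ω hω u hπ hram => ⟨hR π ω hω u hπ hram, ?_⟩, fun π => ?_, fun π u hdeg => ?_⟩
  · -- (U) for `L'`: `t_{π^τ, u} = t_{π, u}⁻¹`
    exact hU π.transposeInv u _ (AutomorphicRepData.HasSatakeParamAt.transposeInv hβ)
  · -- (R) for `L'`: `(π ⊗ ω)^τ = π^τ ⊗ ω⁻¹`, `π^τ` unramified at `u`, `ω⁻¹` ramified at `u`
    change L (π.twist ω hω).transposeInv u = 1
    rw [CuspidalAutomorphicRepData.transposeInv_twist]
    exact hR π.transposeInv ω⁻¹ (IsOfFinOrder.inv hω) u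
      (AutomorphicRepData.IsUnramifiedAt.transposeInv hπ) (mt isUnramifiedAt_inv_iff'.1 hram)
  · -- (N): the larger of the two bounds for `π` and `π^τ`
    choose M₁ hM₁pos hM₁ using fun u => exists_bound_hasRSLFactor_localComponent_twist_eq_one π u
    choose M₂ hM₂pos hM₂ using fun u =>
      exists_bound_hasRSLFactor_localComponent_twist_eq_one π.transposeInv u
    refine ⟨fun u => max (M₁ u) (M₂ u), fun ω hω u hdeep => ⟨?_, ?_⟩⟩
    · exact eq_one_of_forall_localComponent (π.twist ω hω) u (hL _ u).2.2
        (hM₁ u ω hω fun k hk hkM => hdeep k hk (hkM.trans (le_max_left _ _)))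
    · change L (π.twist ω hω).transposeInv u = 1
      rw [CuspidalAutomorphicRepData.transposeInv_twist]
      refine eq_one_of_forall_localComponent _ u (hL _ u).2.2
        (hM₂ u ω⁻¹ (IsOfFinOrder.inv hω) fun k hk hkM => ?_)
      rw [inv_pow]
      exact fun h => hdeep k hk (hkM.trans (le_max_right _ _)) (isUnramifiedAt_inv_iff'.1 h)
  · -- (conv-U): degree `2` forces a spherical local component, hence a Satake parameter
    obtain ⟨πu, hloc⟩ := AutomorphicRepData.exists_hasLocalComponentAt_of_isAdmissible
      (automorphicRep_isAdmissible_holds hcpt) π.1 u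
    have hψ₀ : ((adeleAddChar F).adicComponent u).IsContinuousNontrivial :=
      (isGlobalAddChar_adeleAddChar F).isContinuousNontrivial_adicComponent
        (adicComponent_adeleAddChar_ne_one u)
    letI mF : MeasurableSpace (u.adicCompletion F) := borel _
    haveI : BorelSpace (u.adicCompletion F) := ⟨rfl⟩
    obtain ⟨x₀, hx₀, hK₀⟩ := exists_mem_fixedPoints_glInt_of_hasRSLFactor_natDegree_two πu _ hψ₀
      @fun _ _ ν _ _ _ => ⟨L π u, (hL π u).2.2 πu hloc _ hψ₀ ν, hdeg⟩
    obtain ⟨B, hB⟩ :=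
      isUnramifiedAt_of_hasLocalComponentAt_of_mem_fixedPoints_glInt π.1 u πu hloc hx₀ hK₀
    exact ⟨B, fun h0 => hasSatakeParamAt_ne_zero_holds hB 0 h0 rfl, hU π u B hB, hB⟩

end Literature.NumberTheory.Automorphic

end
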